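import Summits.ResolutionOfSingularities.ResolutionOfSingularities.Theorems.FrobeniusClosingPatchingRelPerfectDepthMultiHostFormat
import Summits.ResolutionOfSingularities.ResolutionOfSingularities.Theorems.FrobeniusClosingPatchingRelPerfectDepthLocalMonomialSumOpen
import Summits.ResolutionOfSingularities.ResolutionOfSingularities.Theorems.FrobeniusClosingPatchingRelPerfectMonomialSumStratumStep
import HarnessLib

/-!
# Crux `PatchingRelPerfect` (stmt-ResolutionOfSingularities-16161), chain W5.2 — F7(β) d = 2: `MultiHostFormatB`, END MODULE —
# the local END `IsEndOn U`, its bridge to T7β-M, and END-STABILITY (T1): the monomial-sum step laws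

[OURS · L1 W5.2 · F7(β) X-side · res-L1-w52-plan-1 NAMING G11-4 (3) «END must be `IsEndOn U` … then (L6) END-STABILITY (= stub-2΄s (T1),
folded here per G11-3 (1)): a `step` along W with `HasSNCWith 𝓔 𝓘_W` keeps «summand i monomial on U′ := τ⁻¹U» for every summand
already monomial (p538305 with `D i := ⊤` + `HasSNCWith.hasSNC_transform`)»; NAMING G11-1 (1) «state it for the CONTROLLED transform of
any weight ν ≤ min over the summands of the T-exponent sum (ν = 0 = total transform included) … in the T7β-M currency».]  Replaces the
role of NO printed item; NOT a statement of the manuscript under review; fact-free.  AI-written; AI review is weaker than expert review.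
OURS definition `IsEndOn` (statement-lane rules: no instances, no notation).

## Contents (namespace `…Theorems.DepthMultiHost`)
§1 (T1) THE MONOMIAL-SUM STEP LAWS — a finite sum of monomials `monomialSum 𝒦` on one member family `Es` stays a finite sum of
monomials under the weight-`ν` controlled transform along
* an IRREDUCIBLE closed centre `W` (generic point `η`) with `HasSNCWith Es 𝓘_W` and `ν ≤ weightAt L η` for every list
  (`comap_monomialSum_of_isGenericPoint` — total transform `τ^*Σ = F^ν · Σ′`; `controlledTransform_monomialSum_of_isGenericPoint` —
  `τᶜ(Σ, ν) = Σ′`, the lists `L.map st ++ [(F, weightAt L η − ν)]`; from p538305 with host `⊤`, order `0`), and along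
* a STRATUM `T.sup id` of `Es` (`HasSNC Es`, `T ⊆ Es`, `ν ≤ weightOf L T`; reducible strata allowed):
  `controlledTransform_monomialSum_stratum` — `πᶜ(Σ, ν) = monomialSum (𝒦.map (transformExp · π T ν))` (res-type-084/MonomialCleanup's
  total-transform law `comap_monomialSum_eq_pow_mul` + Cartier cancellation);
with the successor member family `Es.map st ++ [F]` snc (`HasSNCWith.hasSNC_transform`) and carrying every successor list
(`boundaryOf_of_mem_map_append`).  So a Phase C step aimed at one host never un-ENDs the summands that are already monomial; in
`MultiHostState` terms `step_host_eq_top` (host `⊤`, order `0` ⇒ host `⊤`).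
§2 `MultiHostState.IsEndOn S U` — the LOCAL END in the intermediate currency of plan-1's Q9 reading: GLOBAL candidate members `𝓕` and
lists `𝒦`, simple normal crossings and the equality `K|_U = (monomialSum 𝒦)|_U` only ON the open `U ⊇ cosupp K`;
`IsEnd.isEndOn` (global END ⇒ local END on its `U`); **`IsEndOn.exists_centreSeq`** — local END ⇒ principalization of `K` by regular
centres over the cosupport, regular top (`DepthTargets.monomialSumPrincipalization_of_comap_eq_comap`, p541565).

## References
* J. Kollár, *Lectures on Resolution of Singularities* (2007), (3.111) Steps 1–3, Def. 3.65. [Kollar2007]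
* E. Bierstone, D. Grigoriev, P. Milman, J. Włodarczyk, *Effective Hironaka resolution and its complexity*, Asian J. Math. 15 (2011),
  Def. 3.1.3, Lemma 3.2.1, §4 Step 2b. [BierstoneGrigorievMilmanWlodarczyk2011]
* U. Görtz, T. Wedhorn, *Algebraic Geometry I* (2nd ed., 2020), Prop. 13.91. [GortzWedhorn2020]
-/

-- `Summit.<Summit>.<Sub>.Theorems` with `Sub = Summit` (single-conjunct summit, D-0017)
set_option linter.dupNamespace false

noncomputable section

open CategoryTheory AlgebraicGeometry TopologicalSpace
open Literature.AlgebraicGeometry.Resolution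
open Literature.AlgebraicGeometry.Hironaka2017.MonomialPart
open Scheme.IdealSheafData

namespace Summit.ResolutionOfSingularities.ResolutionOfSingularities.Theorems.DepthMultiHost

universe u

variable {X X' : Scheme.{u}}

/-! ## §1 (T1) The monomial-sum step laws -/

section IrreducibleCentre

variable [IsLocallyNoetherian X] {τ : X' ⟶ X} {W : Closeds X} {η : X} {Es : List X.IdealSheafData}
  {𝒦 : List (List (X.IdealSheafData × ℕ))} {ν : ℕ}

/-- **Total transform of a monomial sum along an irreducible centre**: `τ^*(Σ_L x^L) = F^ν · Σ_L (x'^{L} · F^{w_L(η) − ν})` for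
`ν ≤ w_L(η)` = the weight of `L` at the generic point `η` of `W` (members not containing `W` contribute nothing), `Es` snc with `𝓘_W`.
[cite: Kollar2007, (3.111) Step 3] [cite: BierstoneGrigorievMilmanWlodarczyk2011, Lemma 3.2.1] -/
theorem comap_monomialSum_of_isGenericPoint (hη : IsGenericPoint η (W : Set X)) (hb : ∀ L ∈ 𝒦, boundaryOf L = Es)
    (hsnc : HasSNCWith Es (vanishingIdeal W)) (hτ : IsBlowup τ (vanishingIdeal W)) (hν : ∀ L ∈ 𝒦, ν ≤ weightAt L η) :
    (DepthTargets.monomialSum 𝒦).comap τ =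
      (vanishingIdeal W).comap τ ^ ν * DepthTargets.monomialSum (𝒦.map fun L =>
        (L.map fun p => (strictTransformIdeal τ (vanishingIdeal W) p.1, p.2)) ++
          [((vanishingIdeal W).comap τ, weightAt L η - ν)]) := by
  induction 𝒦 with
  | nil =>
    rw [List.map_nil, DepthTargets.monomialSum_nil, DepthTargets.monomialSum_nil, Scheme.IdealSheafData.comap_bot,
      Scheme.IdealSheafData.mul_bot]
  | cons A 𝒦 ih =>
    have hA : boundaryOf A = Es := hb A (by simp)
    have hcA := DepthCylinderCentre.comap_host_mul_monomialIdeal_of_isGenericPoint (τ := τ) (ℬ := A) hη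
      (𝔟 := monomialIdeal A) (D := ⊤) (m := 0) (by rw [Scheme.IdealSheafData.top_mul])
      (by rw [pow_zero, Scheme.IdealSheafData.one_eq_top]) (hA.symm ▸ hsnc) hτ
    rw [controlledTransform_zero, Scheme.IdealSheafData.comap_top, Scheme.IdealSheafData.top_mul, zero_add] at hcA
    rw [List.map_cons, DepthTargets.monomialSum_cons, DepthTargets.monomialSum_cons, Scheme.IdealSheafData.comap_sup,
      ih (fun B hB => hb B (List.mem_cons_of_mem _ hB)) (fun B hB => hν B (List.mem_cons_of_mem _ hB)), hcA,
      monomialIdeal_append, monomialIdeal_singleton, ← add_eq_sup, ← add_eq_sup, mul_add]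
    congr 1
    dsimp only
    rw [mul_comm (monomialIdeal _) (_ ^ _), ← mul_assoc, ← pow_add, Nat.add_sub_cancel' (hν A (by simp))]

/-- **(T1) Controlled transform of a monomial sum along an irreducible centre**: `τᶜ(Σ_L x^L, ν) = Σ_L x'^{L} · F^{w_L(η) − ν}` — a finite
sum of monomials on `Es` becomes a finite sum of monomials on `Es.map st ++ [F]`. [cite: Kollar2007, (3.111) Step 3]
[cite: BierstoneGrigorievMilmanWlodarczyk2011, §4 Step 2b] -/
theorem controlledTransform_monomialSum_of_isGenericPoint (hη : IsGenericPoint η (W : Set X))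
    (hb : ∀ L ∈ 𝒦, boundaryOf L = Es) (hsnc : HasSNCWith Es (vanishingIdeal W)) (hτ : IsBlowup τ (vanishingIdeal W))
    (hν : ∀ L ∈ 𝒦, ν ≤ weightAt L η) :
    controlledTransform τ (vanishingIdeal W) (DepthTargets.monomialSum 𝒦) ν =
      DepthTargets.monomialSum (𝒦.map fun L =>
        (L.map fun p => (strictTransformIdeal τ (vanishingIdeal W) p.1, p.2)) ++
          [((vanishingIdeal W).comap τ, weightAt L η - ν)]) := by
  haveI : IsProper τ := hτ.isProper
  haveI : IsLocallyNoetherian X' := LocallyOfFiniteType.isLocallyNoetherian τ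
  unfold controlledTransform
  rw [comap_monomialSum_of_isGenericPoint hη hb hsnc hτ hν]
  exact colon_pow_mul_eq hτ.isEffectiveCartier _ ν

omit [IsLocallyNoetherian X] in
/-- Every successor list lives on the successor member family `Es.map st ++ [F]`. [folklore] -/
theorem boundaryOf_of_mem_map_append (hb : ∀ L ∈ 𝒦, boundaryOf L = Es) (C : X.IdealSheafData) (e : List (X.IdealSheafData × ℕ) → ℕ)
    (L' : List (X'.IdealSheafData × ℕ))
    (hL' : L' ∈ 𝒦.map fun L => (L.map fun p => (strictTransformIdeal τ C p.1, p.2)) ++ [(C.comap τ, e L)]) :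
    boundaryOf L' = Es.map (strictTransformIdeal τ C) ++ [C.comap τ] := by
  obtain ⟨L, hL, rfl⟩ := List.mem_map.mp hL'
  rw [DepthTargets.boundaryOf_map_strictTransform_append, hb L hL]

omit [IsLocallyNoetherian X] in
/-- The successor lists are as many as the lists (in particular non-empty iff). [folklore] -/
theorem map_append_ne_nil (h𝒦 : 𝒦 ≠ []) (C : X.IdealSheafData) (e : List (X.IdealSheafData × ℕ) → ℕ) :
    (𝒦.map fun L => (L.map fun p => (strictTransformIdeal τ C p.1, p.2)) ++ [(C.comap τ, e L)]) ≠ [] :=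
  fun h => h𝒦 (List.map_eq_nil_iff.mp h)

/-- The successor member family is snc (Kollár Def. 3.25, re-exported for the record). [cite: Kollar2007, Def. 3.25] -/
theorem hasSNC_map_append (hsnc : HasSNCWith Es (vanishingIdeal W)) (hτ : IsBlowup τ (vanishingIdeal W)) :
    HasSNC (Es.map (strictTransformIdeal τ (vanishingIdeal W)) ++ [(vanishingIdeal W).comap τ]) :=
  hsnc.hasSNC_transform hτ

end IrreducibleCentre

section Stratum

variable [IsLocallyNoetherian X] {π : X' ⟶ X} {T : Finset X.IdealSheafData} {Es : List X.IdealSheafData}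
  {𝒦 : List (List (X.IdealSheafData × ℕ))} {ν : ℕ}

/-- **(T1) Controlled transform of a monomial sum along a STRATUM** `T.sup id` of the snc family `Es` (reducible strata allowed),
weight `ν ≤ weightOf L T` for every list (`ν = 0`: the total transform): `πᶜ(Σ_L x^L, ν) = Σ_L x^{transformExp L π T ν}`.
[cite: Kollar2007, (3.111) Step 3, Def. 3.65] -/
theorem controlledTransform_monomialSum_stratum (hEs : HasSNC Es) (hb : ∀ L ∈ 𝒦, boundaryOf L = Es)
    (hT : ∀ K ∈ T, K ∈ Es) (hπ : IsBlowup π (T.sup id)) (hν : ∀ L ∈ 𝒦, ν ≤ weightOf L T) :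
    controlledTransform π (T.sup id) (DepthTargets.monomialSum 𝒦) ν =
      DepthTargets.monomialSum (𝒦.map fun L => transformExp L π T ν) := by
  haveI : IsProper π := hπ.isProper
  haveI : IsLocallyNoetherian X' := LocallyOfFiniteType.isLocallyNoetherian π
  unfold controlledTransform
  rw [MonomialCleanup.comap_monomialSum_eq_pow_mul hEs hb hT hπ hν]
  exact colon_pow_mul_eq hπ.isEffectiveCartier _ ν

omit [IsLocallyNoetherian X] in
/-- The stratum successor lists live on `Es.map st ++ [F]`. [folklore] -/
theorem boundaryOf_of_mem_map_transformExp (hb : ∀ L ∈ 𝒦, boundaryOf L = Es) (L' : List (X'.IdealSheafData × ℕ))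
    (hL' : L' ∈ 𝒦.map fun L => transformExp L π T ν) :
    boundaryOf L' = Es.map (strictTransformIdeal π (T.sup id)) ++ [(T.sup id).comap π] := by
  obtain ⟨L, hL, rfl⟩ := List.mem_map.mp hL'
  rw [boundaryOf_transformExp, hb L hL]

/-- The stratum successor family is snc. [cite: Kollar2007, Def. 3.25] -/
theorem hasSNC_map_stratum (hEs : HasSNC Es) (hT : ∀ K ∈ T, K ∈ Es) (hπ : IsBlowup π (T.sup id)) :
    HasSNC (Es.map (strictTransformIdeal π (T.sup id)) ++ [(T.sup id).comap π]) :=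
  (hEs.hasSNCWith_finsetSup T hT).hasSNC_transform hπ

end Stratum

/-! ## §1b END-stability in `MultiHostState` terms -/

namespace MultiHostState

/-- **A monomial summand stays monomial**: a summand with host `⊤` stepped with order `0` has host `⊤` again (`τᶜ(⊤, 0) = ⊤`), so a
step aimed at one host never un-ENDs the others. [folklore] -/
theorem step_host_eq_top [IsLocallyNoetherian X] (S : MultiHostState X) (τ : X' ⟶ X) (W : Closeds X) (η : X) (m : Fin S.n → ℕ)
    (ν : ℕ) (hsnc : HasSNCWith S.𝓔 (vanishingIdeal W)) (hτ : IsBlowup τ (vanishingIdeal W)) {i : Fin S.n} (hi : S.host i = ⊤)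
    (hm : m i = 0) : (S.step τ W η m ν hsnc hτ).host i = ⊤ := by
  rw [step_host, hi, hm, controlledTransform_zero, Scheme.IdealSheafData.comap_top]

/-- The order-`0` host hypothesis of `K_step` is free for a host-`⊤` summand. [folklore] -/
theorem host_le_pow_zero (S : MultiHostState X) (W : Closeds X) (i : Fin S.n) : S.host i ≤ vanishingIdeal W ^ 0 := by
  rw [pow_zero, Scheme.IdealSheafData.one_eq_top]
  exact le_top

/-! ## §2 The local END `IsEndOn` and its bridge to T7β-M -/

/-- [OURS · L1 W5.2] **LOCAL END of the multi-host game on the open `U`** (res-L1-w52-plan-1 G11-4 (3), the Q9 reading): GLOBAL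
candidate members `𝓕` and exponent lists `𝒦 ≠ []` on `𝓕` such that ON `U ⊇ cosupp K` the members have simple normal crossings and
`K|_U = (monomialSum 𝒦)|_U` (host-private members — strict transforms of host hypersurfaces — are snc only near the cosupport).
[cite: BierstoneGrigorievMilmanWlodarczyk2011, Def. 3.1.3] [cite: Kollar2007, (3.111) Step 3] -/
def IsEndOn (S : MultiHostState X) (U : X.Opens) : Prop :=
  ∃ (𝓕 : List X.IdealSheafData) (𝒦 : List (List (X.IdealSheafData × ℕ))),
    (∀ L ∈ 𝒦, boundaryOf L = 𝓕) ∧ 𝒦 ≠ [] ∧ HasSNC (𝓕.map fun F => F.comap U.ι) ∧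
    (S.K.support : Set X) ⊆ (U : Set X) ∧ S.K.comap U.ι = (DepthTargets.monomialSum 𝒦).comap U.ι

/-- Global END ⇒ local END on its open. [folklore] -/
theorem IsEnd.isEndOn {S : MultiHostState X} (h : S.IsEnd) : ∃ U, S.IsEndOn U := by
  obtain ⟨U, 𝓕, 𝒦, h𝒦, hne, hsnc, hsupp, hK⟩ := h
  exact ⟨U, 𝓕, 𝒦, h𝒦, hne, hsnc, hsupp, by rw [hK]⟩

/-- **LOCAL END ⇒ principalization** (T7β-M in local-presentation currency, p541565): on a regular Noetherian `X`, a state that is END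
on some open `U` has its `K` principalized by a sequence of blowings up with regular centres over `cosupp K`, regular top.
[cite: Kollar2007, (3.111) Step 3] [cite: GortzWedhorn2020, Prop. 13.91 (1)–(2)] -/
theorem IsEndOn.exists_centreSeq [IsNoetherian X] (hX : Scheme.IsRegular X) {S : MultiHostState X} {U : X.Opens}
    (h : S.IsEndOn U) :
    ∃ s : CentreSeq X, s.AllRegular ∧ s.CentresOver (S.K.support : Set X) ∧ Scheme.IsRegular s.top ∧
      IsLocallyPrincipal (S.K.comap s.comp) := by
  obtain ⟨𝓕, 𝒦, h𝒦, hne, hsnc, hsupp, hK⟩ := h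
  haveI : CompactSpace (U : Scheme.{u}) :=
    isCompact_iff_compactSpace.mp (TopologicalSpace.NoetherianSpace.isCompact (U : Set X))
  haveI : IsNoetherian (U : Scheme.{u}) := ⟨⟩
  have hsupp' : (S.K.support : Set X) ⊆ Set.range U.ι.base := by
    rw [Scheme.Opens.range_ι]
    exact hsupp
  exact DepthTargets.monomialSumPrincipalization_of_comap_eq_comap hX U.ι S.K hsupp' 𝓕 hsnc 𝒦 h𝒦 hne hK

end MultiHostState

end Summit.ResolutionOfSingularities.ResolutionOfSingularities.Theorems.DepthMultiHost

end
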